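import Summits.CriticalPhenomena.PercolationContinuityZ3.Theorems.Transplant.SkelFrmFrom1Serve
import HarnessLib

/-!
# U_s execution Us-1, JUNCTION MODULE 1 (RULING D-Us, lead g21 V147b; design (D-s2‴) 'base-type proxies', P3-NILPOTENT §19.12–§19.13): **THE STEP-I‴ INPUTS SERVED AT A
# FRAME-IMAGE CENTRE** — the four junction lemmas of «SkelFrmFrom1Serve» (`ChoiceNQ.inputsAt_of_atQNQ` / `inputsAt_one_of_atQNQ` / `inputsSelAt_of_atQNQ` / `zoneAt_of_atQNQ`)
# with the one-type hypothesis `h1 : Φ.types = {t}` (used there ONLY to manufacture a `t`-frame at the centre) replaced by the frame itself as a hypothesis: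
# `(α : G ≃g G) (hαt : α t = c) (hφ : φ ∘ α = φ + (φ c − φ t))`

builds on p205010 (kernel theorem, internal audit signed; external expert review pending) — nothing in this file uses p205010; NOTHING is claimed about the OPEN nodes U
(`SamePDropOfSkeletonFrmFrom₁`) or U_s (`SamePDropOfSkeletonFrmScaled₁`); conditional lemmas about an arbitrary choice `𝒞 : ChoiceNQ …` at a running density.
Lane `prim-bschramm`, seat `prim-bschramm-p3` gen 26 (design owner); helper file (`--supports stmt-CriticalPhenomena-4575 --as helper`); NON-VERBATIM (new text, r4), def-free.

WHY (§19.13, junction row 'served piece-links / served zone'): in the MULTI-TYPE coarse skeleton of a one-type scaled skeleton (dictionary parts 1–4) the scheme runs with ONE base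
type `t`, and a centre `c` of another residue class is served through its PROXY `c′` (part 4 «PlanarSkeletonFrmScaledCoarseProxy» p442392: `exists_proxies` gives `c′`, an exact
frame `α : t ↦ c′`, `ψ c′ = ψ c`, `d_G(c, c′) ≤ D`).  These lemmas are the form the GEN rows (Us-3) call: the frame is an INPUT, so no `types = {t}` is needed; the one-type case
recovers «SkelFrmFrom1Serve» through `exists_frame_of_types_eq'` (not restated here).  Proofs = SkelFrm1Serve :78–:118 verbatim after deleting the `obtain ⟨α, hαt, hφ⟩ := exists_frame_of_types_eq' …` line.
[cite: KozmaNitzan2024, §4 pp. 19–21 ((21)–(25): the inputs at every vertex by transitivity), p. 28] [cite: MartineauTassion2017, §3.2] [this work]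
-/

noncomputable section

open scoped Classical

namespace Summit.CriticalPhenomena.PercolationContinuityZ3.Theorems.Transplant

open MeasureTheory Literature.Probability.Percolation Literature.Probability.LatticeModels SimpleGraph KNCells KNLevels

namespace PlanarSkeletonFrmFrom

open SkelConc (Consts)
open Skelφ (oriφ trφ)
open Skelφ.StepI (DataN OutNS eventNAt)

variable {V : Type} [Countable V] {G : SimpleGraph V} [G.LocallyFinite]

namespace ChoiceNQ

/-- **The listed pairs' served piece-links AT A FRAME-IMAGE CENTRE** (`(M, n) ∈ 𝒞.SMn O`; the centre `c = α t` for a frame `α` translating the chart): the input of the chosen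
orientation's map at the SERVED near sign, realised at `c`, from the family of `AtQNQ` — the frame is a hypothesis (U_s: `c` = the proxy of an arbitrary vertex, `α` its exact
coarse frame). [cite: KozmaNitzan2024, §4 pp. 19–21 ((21)–(25))] -/
theorem inputsAt_of_atQNQ_frame {κ : Consts} {Φ : PlanarSkeletonFrmFrom G} {t : V} {p : unitInterval} {hC : Φ.CylSubcritical p} {O : OutNS V} {q : unitInterval}
    (𝒞 : ChoiceNQ κ Φ t p hC) (hAt : 𝒞.AtQNQ O q) {c : V} {α : G ≃g G} (hαt : α t = c)
    (hφ : ∀ w, PlanarSkeletonFrmFrom.φ Φ (α w) = PlanarSkeletonFrmFrom.φ Φ w + (PlanarSkeletonFrmFrom.φ Φ c - PlanarSkeletonFrmFrom.φ Φ t))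
    {M n : ℕ} (hMn : (M, n) ∈ 𝒞.SMn O) (fam : Fin 2) (τ : ℤˣ) :
    1 - 𝒞.δI < (bondPercolation G q).real
      (eventNAt G (oriφ Φ.φ (O.ori t M n)) O.merged.toDataN t c (M, some (n, fam, Skelφ.StepI.sgQ O.qd O.qdT O.ori t M n fam, τ))) := by
  obtain ⟨hfacts, -, -, hin, -⟩ := hAt
  obtain ⟨-, -, -, -, hΛ, e1, e2, e3, -, -, -⟩ := hfacts.1
  simp only [Skelφ.StepI.OutNS.toOutO_D, Skelφ.StepI.OutNS.toOutO_DT] at hΛ e1 e2 e3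
  have ht : t ∈ ({t} : Finset V) := Finset.mem_singleton_self t
  have h := hin _ (Skelφ.StepI.mem_indexNQ_some ht hMn fam τ)
  rw [Skelφ.StepI.eventO_some_eq_eventN_orient Φ.φ e1 e2 e3] at h
  rw [Skelφ.StepI.OutNS.merged_toDataN,
    Skelφ.StepI.real_eventNAt_frame₂ hαt hφ Φ.frame hC q (D := O.D.toDataN.orient O.DT.toDataN O.ori) hΛ (O.ori t M n)]
  exact h

/-- **At a listed pair whose served quadrant is `(E, N)` the served sign is `1`**, at a frame-image centre. [cite: KozmaNitzan2024, §4 pp. 19–21] -/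
theorem inputsAt_one_of_atQNQ_frame {κ : Consts} {Φ : PlanarSkeletonFrmFrom G} {t : V} {p : unitInterval} {hC : Φ.CylSubcritical p} {O : OutNS V} {q : unitInterval}
    (𝒞 : ChoiceNQ κ Φ t p hC) (hAt : 𝒞.AtQNQ O q) {c : V} {α : G ≃g G} (hαt : α t = c)
    (hφ : ∀ w, PlanarSkeletonFrmFrom.φ Φ (α w) = PlanarSkeletonFrmFrom.φ Φ w + (PlanarSkeletonFrmFrom.φ Φ c - PlanarSkeletonFrmFrom.φ Φ t))
    {M n : ℕ} (hMn : (M, n) ∈ 𝒞.SMn O) (hquad : O.quad t M n = (1, 1)) (fam : Fin 2) (τ : ℤˣ) :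
    1 - 𝒞.δI < (bondPercolation G q).real (eventNAt G (oriφ Φ.φ (O.ori t M n)) O.merged.toDataN t c (M, some (n, fam, 1, τ))) := by
  have h := inputsAt_of_atQNQ_frame 𝒞 hAt hαt hφ hMn fam τ
  rwa [Skelφ.StepI.OutNS.sgQ_eq_one_of_quad O hquad] at h

/-- **At the SELECTED pairs the `σ = 1` piece-links are likely at a frame-image centre** (when the choice lists them). [cite: KozmaNitzan2024, §4 pp. 19–21] -/
theorem inputsSelAt_of_atQNQ_frame {κ : Consts} {Φ : PlanarSkeletonFrmFrom G} {t : V} {p : unitInterval} {hC : Φ.CylSubcritical p} {O : OutNS V} {q : unitInterval}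
    (𝒞 : ChoiceNQ κ Φ t p hC) (hAt : 𝒞.AtQNQ O q) {c : V} {α : G ≃g G} (hαt : α t = c)
    (hφ : ∀ w, PlanarSkeletonFrmFrom.φ Φ (α w) = PlanarSkeletonFrmFrom.φ Φ w + (PlanarSkeletonFrmFrom.φ Φ c - PlanarSkeletonFrmFrom.φ Φ t))
    (M₁ N : ℕ) (hMn : (O.D.sM M₁, O.D.sN M₁ N) ∈ 𝒞.SMn O) (fam : Fin 2) (τ : ℤˣ) :
    1 - 𝒞.δI < (bondPercolation G q).real
      (eventNAt G (oriφ Φ.φ (O.ori t (O.D.sM M₁) (O.D.sN M₁ N))) O.merged.toDataN t c (O.D.sM M₁, some (O.D.sN M₁ N, fam, 1, τ))) :=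
  inputsAt_one_of_atQNQ_frame 𝒞 hAt hαt hφ hMn (hAt.1.sel_quad M₁ N) fam τ

/-- **The uniqueness zone at every listed zone size, at a frame-image centre** (`UniqZone.zone G (O.merged.Λ c) O.merged.k M`, `M ∈ 𝒞.Sz O`). [this work] -/
theorem zoneAt_of_atQNQ_frame {κ : Consts} {Φ : PlanarSkeletonFrmFrom G} {t : V} {p : unitInterval} {hC : Φ.CylSubcritical p} {O : OutNS V} {q : unitInterval}
    (𝒞 : ChoiceNQ κ Φ t p hC) (hAt : 𝒞.AtQNQ O q) {c : V} {α : G ≃g G} (hαt : α t = c)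
    (hφ : ∀ w, PlanarSkeletonFrmFrom.φ Φ (α w) = PlanarSkeletonFrmFrom.φ Φ w + (PlanarSkeletonFrmFrom.φ Φ c - PlanarSkeletonFrmFrom.φ Φ t))
    {M : ℕ} (hM : M ∈ 𝒞.Sz O) :
    1 - 𝒞.δI < (bondPercolation G q).real (UniqZone.zone G (O.merged.Λ c) O.merged.k M) := by
  obtain ⟨hfacts, -, -, hin, -⟩ := hAt
  obtain ⟨-, -, -, -, hΛ, -⟩ := hfacts.1
  simp only [Skelφ.StepI.OutNS.toOutO_D] at hΛ
  have ht : t ∈ ({t} : Finset V) := Finset.mem_singleton_self t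
  have hz := hin _ (Skelφ.StepI.mem_indexNQ_none ht hM)
  rw [Skelφ.StepI.eventO_none] at hz
  have h := Skelφ.StepI.real_eventNAt_frame₂ hαt hφ Φ.frame hC q (D := O.D.toDataN.orient O.DT.toDataN O.ori) hΛ true (M, none)
  rw [Skelφ.StepI.eventNAt_none, Skelφ.StepI.eventN_none] at h
  have e : (bondPercolation G q).real (UniqZone.zone G (O.merged.Λ c) O.merged.k M) =
      (bondPercolation G q).real (UniqZone.zone G (O.D.toDataN.Λ t) O.D.toDataN.k M) := h
  rw [e]; exact hz

end ChoiceNQ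

end PlanarSkeletonFrmFrom

end Summit.CriticalPhenomena.PercolationContinuityZ3.Theorems.Transplant

end
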